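import Mathlib
import HarnessLib
import Summits.AtomisticToContinuum.Crystallization.Theorems.FrustratedLawDichotomyAperiodicFrustratedLawGapErgodicAtoms
import Literature.Probability.Process.RootedHardCoreConfig

/-!
# Ergodic reduction for the crux `AperiodicFrustratedLawGap` — a countable π-system of configuration sets, and
# conditional laws constant on atoms

Route `FrustratedLawDichotomy`, crux `AperiodicFrustratedLawGap` (item `stmt-AtomisticToContinuum-27623`),
registered stub `stub_ergodicReduction` (skeleton `dd3251ad731e`); bricks for steps S2/S4 of the `hErg` plan
(evidence `D5-PLAN.md`):

* `exists_piSystem_config` — on the compact configuration space `RootedHardCoreConfig ℝ³ δ` there is a family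
  `d : Finset ℕ → Set X` of open sets, closed under intersection (`d F ∩ d G = d (F ∪ G)`), with `d ∅ = univ`,
  generating the Borel σ-algebra (finite intersections of a countable basis);
* `measure_ext_of_piSystem_config` — two finite measures with equal total mass agreeing on all `d F` are equal;
* `ae_condExpKernel_eq_on_levelSet` — **conditional laws are constant on atoms**: for the conditional laws
  `κ = condExpKernel Q m` (any sub-σ-algebra `m`, packaged as a subtype) and any countable family of
  `m`-measurable real functions `h i` containing the evaluations `ω ↦ (κ_ω(d F)).toReal`, `Q`-a.e. `ω` has:
  `κ_ω`-a.e. `ω'` lies in the joint level set of `ω`, and every `ω'` in that level set has `κ_{ω'} = κ_ω`.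

`[folklore]`.
-/

noncomputable section

namespace Summit.AtomisticToContinuum.Crystallization.Theorems.FrustratedLawDichotomyErgodicReduction

open MeasureTheory Set Filter ProbabilityTheory TopologicalSpace
open scoped ENNReal
open Literature.Probability.Process (LocalConfig)
open Literature.Probability.Process.LocalConfig (RootedHardCoreConfig)

variable {δ : ℝ}

/-- **A countable π-system generating the Borel sets of the configuration space**, indexed by finite sets of
naturals (finite intersections of a countable basis; the empty intersection is `univ`). [folklore] -/
theorem exists_piSystem_config [Fact (0 < δ)] :
    ∃ d : Finset ℕ → Set (RootedHardCoreConfig (EuclideanSpace ℝ (Fin 3)) δ),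
      (∀ F, IsOpen (d F)) ∧ (∀ F, MeasurableSet (d F)) ∧ d ∅ = univ ∧ (∀ F G, d F ∩ d G = d (F ∪ G)) ∧
      (inferInstance : MeasurableSpace (RootedHardCoreConfig (EuclideanSpace ℝ (Fin 3)) δ)) =
        MeasurableSpace.generateFrom (Set.range d) := by
  have hB := isBasis_countableBasis (RootedHardCoreConfig (EuclideanSpace ℝ (Fin 3)) δ)
  have hne : (countableBasis (RootedHardCoreConfig (EuclideanSpace ℝ (Fin 3)) δ)).Nonempty := by
    have p : RootedHardCoreConfig (EuclideanSpace ℝ (Fin 3)) δ :=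
      ⟨LocalConfig.mk {0}, Set.mem_singleton _, fun x hx y hy hxy =>
        (hxy ((show x = 0 from hx).trans (show y = 0 from hy).symm)).elim⟩
    obtain ⟨u, hu, -, -⟩ := hB.exists_subset_of_mem_open (mem_univ p) isOpen_univ
    exact ⟨u, hu⟩
  obtain ⟨b, hb⟩ := (countable_countableBasis (RootedHardCoreConfig (EuclideanSpace ℝ (Fin 3)) δ)).exists_eq_range hne
  have hbo : ∀ k, IsOpen (b k) := fun k => hB.isOpen (hb ▸ mem_range_self k)
  refine ⟨fun F => ⋂ i ∈ F, b i, fun F => isOpen_biInter_finset fun i _ => hbo i,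
    fun F => (isOpen_biInter_finset fun i _ => hbo i).measurableSet, by simp, fun F G => ?_, ?_⟩
  · ext S
    simp only [mem_inter_iff, mem_iInter, Finset.mem_union]
    exact ⟨fun h i hi => hi.elim (h.1 i) (h.2 i), fun h => ⟨fun i hi => h i (Or.inl hi), fun i hi => h i (Or.inr hi)⟩⟩
  · refine le_antisymm ?_ (MeasurableSpace.generateFrom_le ?_)
    · rw [BorelSpace.measurable_eq (α := RootedHardCoreConfig (EuclideanSpace ℝ (Fin 3)) δ), hB.borel_eq_generateFrom]
      refine MeasurableSpace.generateFrom_le fun u hu => ?_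
      rw [hb] at hu
      obtain ⟨k, rfl⟩ := hu
      exact MeasurableSpace.measurableSet_generateFrom ⟨{k}, by simp⟩
    · rintro _ ⟨F, rfl⟩
      exact (isOpen_biInter_finset fun i _ => hbo i).measurableSet

/-- **Uniqueness on the π-system**: two finite measures on the configuration space with the same total mass which
agree on every set `d F` of a family as in `exists_piSystem_config` are equal. [folklore] -/
theorem measure_ext_of_piSystem_config
    {d : Finset ℕ → Set (RootedHardCoreConfig (EuclideanSpace ℝ (Fin 3)) δ)}
    (hdi : ∀ F G, d F ∩ d G = d (F ∪ G))
    (hgen : (inferInstance : MeasurableSpace (RootedHardCoreConfig (EuclideanSpace ℝ (Fin 3)) δ)) =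
      MeasurableSpace.generateFrom (Set.range d))
    {μ ν : Measure (RootedHardCoreConfig (EuclideanSpace ℝ (Fin 3)) δ)} [IsFiniteMeasure μ]
    (huniv : μ univ = ν univ) (h : ∀ F, μ (d F) = ν (d F)) : μ = ν := by
  refine ext_of_generate_finite (Set.range d) hgen ?_ (by rintro _ ⟨F, rfl⟩; exact h F) huniv
  rintro _ ⟨F, rfl⟩ _ ⟨G, rfl⟩ -
  exact ⟨F ∪ G, (hdi F G).symm⟩

section Atoms

variable {Ω : Type*} {m : MeasurableSpace Ω} [mΩ : MeasurableSpace Ω] [StandardBorelSpace Ω]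
  {Q : Measure Ω} [IsProbabilityMeasure Q]

/-- **Conditional laws are constant on atoms** (generic form).  Let `κ = condExpKernel Q m`, let `ι` be countable,
`c : ι → Set Ω` measurable sets on which equality of probability measures is decided
(`∀ μ ν prob, (∀ i, μ (c i) = ν (c i)) → μ = ν`), and `h : ℕ → Ω → ℝ` `m`-measurable functions among which all
evaluations `ω ↦ (κ_ω (c i)).toReal` occur.  Then for `Q`-a.e. `ω`: `κ_ω {ω' | ∀ n, h n ω' = h n ω} = 1`, and
every `ω'` with `∀ n, h n ω' = h n ω` has `κ_{ω'} = κ_ω`. [folklore] -/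
theorem ae_condExpKernel_eq_on_levelSet (hm : m ≤ mΩ) {ι : Type*} {c : ι → Set Ω}
    (hext : ∀ μ ν : Measure Ω, IsProbabilityMeasure μ → IsProbabilityMeasure ν →
      (∀ i, μ (c i) = ν (c i)) → μ = ν)
    {h : ℕ → Ω → ℝ} (hh : ∀ n, Measurable[m] (h n))
    (heval : ∀ i, ∃ n, h n = fun ω => (condExpKernel Q m ω (c i)).toReal) :
    ∀ᵐ ω ∂Q, condExpKernel Q m ω {ω' | ∀ n, h n ω' = h n ω} = 1 ∧
      ∀ ω', (∀ n, h n ω' = h n ω) → condExpKernel Q m ω' = condExpKernel Q m ω := by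
  filter_upwards [ae_condExpKernel_levelSet_eq_one (Q := Q) hm hh] with ω hω
  refine ⟨hω, fun ω' hω' => ?_⟩
  refine hext _ _ inferInstance inferInstance fun i => ?_
  obtain ⟨n, hn⟩ := heval i
  have h1 := hω' n
  rw [hn] at h1
  exact (ENNReal.toReal_eq_toReal_iff' (measure_ne_top _ _) (measure_ne_top _ _)).1 h1

end Atoms

end Summit.AtomisticToContinuum.Crystallization.Theorems.FrustratedLawDichotomyErgodicReduction

end
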